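import Summits.NavierStokesRegularity.NavierStokesRegularity.Theorems.FilamentSkeletonRssSkeletonJ1RLiaSelfReference
import Summits.NavierStokesRegularity.NavierStokesRegularity.Theorems.FilamentSkeletonRssSkeletonJ1RLiaDefectSelfArith

/-!
# Route `FilamentSkeletonRss` · crux `SkeletonJ1R` (stmt-NavierStokesRegularity-23610) · stub F2 `LiaDefectL` — Γ-BOOKKEEPING BRICK (B1):
# the self-strand term of the defect of the LIA reference is `O((√Γ + |τ|)/√log Γ)` (RATE B), constants uniform in the datum class

Lead `ns-fsr-lead-23610` (g2), line `streamline_kantorovich_R` (skeleton of record v5).  Helper file `--supports stmt-NavierStokesRegularity-23610`;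
route-independent (no `Theses` import).

`selfTerm_bound`: given the datum CLASS constants (`N`, parameter floor `θp` with `θp ≤ |γ_j|`, `|γ_k|, |α| ≤ θp⁻¹`, separation `ρd`, waist radius
`Rwd ≥ ‖q_k‖`, tolerance `Rb > 0`, a Lipschitz constant `C` of `Real.smoothTransition`) there are `Cself, Lmin` such that for every `Γ > 1` with
`log Γ ≥ Lmin`, every such datum in general position `θg ∈ (0,1]`, THE local-induction reference `x` with tilt `≤ Rb/8 ≤ θ₁` (`θ₁ ≤ ½` inside the
partner-distance budget), every filament `j` and every `|τ| ≤ 3Rb√Γ√log Γ`: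
`‖(Γγ_j/4π) • S_j(τ) − liaCoeff • x_j′τ × x_j″τ‖ ≤ Cself · (√Γ + |τ|)/√(log Γ)`.
This is brick S4 (`IsLiaReference.selfStrand_sub_lia_le`) with the window `R = r₀√Γ` (`r₀ = e·exp 1/2`, so that the Rosenhead coefficient is
`log Γ/2 + O(1/Γ)` = `liaCoeff/(Γγ_j/4π)` up to `e²/R²`), `L = R + 2ℓ`, and envelope parameters chosen as explicit multiples of `b = 8π/(θp Γ log Γ) ≥ |β⁻¹|`;
every one of the seven resulting terms is `≤ const·(√Γ + |τ|)/√log Γ` once `|τ| ≤ 3ℓ` (the switched region) and `log Γ` is large.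
HONEST FRAMING: MODEL rung, ∃-side helper lemmas toward stub F2 of a HYPOTHETICAL filament-type blow-up skeleton; F2 and the crux 23610 stay OPEN;
nothing here bears on Navier–Stokes regularity, which is NOT proved. [folklore]
-/

-- `dupNamespace` off: the module name repeats `NavierStokesRegularity` by the tree's `Summits/<S>/<S>/Theorems` layout (same as every sibling file).
set_option linter.dupNamespace false
-- `unusedTactic`/`unreachableTactic` off: the `first | (field_simp; ring) | field_simp` closers below are robust to how far `field_simp` normalises.
set_option linter.unusedTactic false
set_option linter.unreachableTactic false

noncomputable section

namespace Summit.NavierStokesRegularity.NavierStokesRegularity.Theorems.SkeletonJ1RFrame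

open Set Function Filter Real Topology MeasureTheory
open Literature.Analysis.FluidPDE
open Summit.NavierStokesRegularity.NavierStokesRegularity.Theorems.SkeletonJ1RLiaSelf (abs_liaWindowCoeff_sub_log_le liaWindowCoeff_nonneg)
open scoped InnerProductSpace BigOperators

set_option maxHeartbeats 1600000 in
/-- **The self-strand term is `O((√Γ + |τ|)/√log Γ)`** (see the module docstring). [folklore] -/
theorem selfTerm_bound (N : ℕ) {θp ρd Rwd Rb C : ℝ} (hθp : 0 < θp) (hρ : 0 < ρd) (hRwd : 0 ≤ Rwd) (hRb : 0 < Rb)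
    (hC0 : 0 ≤ C) (hC : ∀ a b : ℝ, |Real.smoothTransition a - Real.smoothTransition b| ≤ C * |a - b|) :
    ∃ Cself Lmin : ℝ, 0 ≤ Cself ∧ ∀ {Γ θg : ℝ} {p t : Fin N → EuclideanSpace ℝ (Fin 3)} {γ : Fin N → ℝ} {α : ℝ} {s₀ : Fin N → ℝ}
      {x : Fin N → ℝ → EuclideanSpace ℝ (Fin 3)}, 1 < Γ → Lmin ≤ Real.log Γ → IsLiaReference Γ Rb p t γ α s₀ x → (∀ k, ‖t k‖ = 1) →
      0 < θg → θg ≤ 1 → (∀ j k, j ≠ k → |inner ℝ (t j) (t k)| ≤ 1 - θg) →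
      (∀ j k, j ≠ k → ∀ a b : ℝ, ρd ≤ ‖(p j + a • t j) - (p k + b • t k)‖) →
      ∀ (j : Fin N) {θ₁ : ℝ}, 0 ≤ θ₁ → θ₁ ≤ 1 / 2 →
      (∀ k, k ≠ j → θ₁ ≤ min (Real.sqrt θg / 4) (θg * ρd / (16 * (‖(p j + s₀ j • t j) - (p k + s₀ k • t k)‖ + ρd)))) →
      (∀ σ, ‖deriv (x j) σ - t j‖ ≤ Rb / 8) → Rb / 8 ≤ θ₁ → θp ≤ |γ j| → (∀ k, |γ k| ≤ θp⁻¹) → |α| ≤ θp⁻¹ →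
      (∀ k, ‖p k + s₀ k • t k‖ ≤ Rwd) → ∀ {τ : ℝ}, |τ| ≤ 3 * Rb * Real.sqrt Γ * Real.sqrt (Real.log Γ) →
      ‖(Γ * γ j / (4 * Real.pi)) • (∫ σ : ℝ, ((‖x j τ - x j σ‖ ^ 2 +
          Real.exp (-(1+Real.eulerMascheroniConstant-Real.log 2)) * (1:ℝ)) ^ (3 / 2 : ℝ))⁻¹ • cross (deriv (x j) σ) (x j τ - x j σ)) -
        liaCoeff Γ γ j • cross (deriv (x j) τ) (deriv (deriv (x j)) τ)‖ ≤
        Cself * (Real.sqrt Γ + |τ|) / Real.sqrt (Real.log Γ) := by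
  -- the universal constants
  set a₀ : ℝ := Real.exp (-(1+Real.eulerMascheroniConstant-Real.log 2)) * (1:ℝ) with ha₀
  have ha₀0 : 0 < a₀ := coreConst_pos
  set e : ℝ := Real.sqrt a₀ with he
  have he0 : 0 < e := Real.sqrt_pos.2 ha₀0
  have he2 : e ^ 2 = a₀ := Real.sq_sqrt ha₀0.le
  set r₀ : ℝ := e * Real.exp 1 / 2 with hr₀
  have hr₀0 : 0 < r₀ := by positivity
  -- the datum-class constants
  set B₀ : ℝ := N / (Real.pi * θp * ρd) with hB₀
  set Q₀ : ℝ := 1 / 2 + θp⁻¹ with hQ₀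
  set e₀ : ℝ := B₀ + Q₀ * Rwd with he₀
  set kR : ℝ := e₀ + Q₀ * (1 + r₀) with hkR
  set cu : ℝ := 1 + 3 * Rb with hcu
  set bx : ℝ := Rwd + 1 + r₀ with hbx
  set wb : ℝ := B₀ + Q₀ * bx with hwb
  set lw : ℝ := 6 * N / (Real.pi * θp * ρd ^ 2) + Q₀ with hlw
  set h₀ : ℝ := 2 * C * bx * wb * cu ^ 2 / Rb ^ 2 + 8 * Real.pi * kR * wb * cu ^ 2 / θp + lw with hh₀
  set κ : ℝ := 2 / θp ^ 2 with hκ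
  set δ₀ : ℝ := 8 * Real.pi * kR * r₀ * cu / θp with hδ₀
  have hB₀0 : 0 ≤ B₀ := by positivity
  have hQ₀0 : 0 < Q₀ := by positivity
  have he₀0 : 0 ≤ e₀ := by positivity
  have hkR0 : 0 < kR := by positivity
  have hcu0 : 0 < cu := by positivity
  have hbx0 : 0 < bx := by positivity
  have hwb0 : 0 < wb := by positivity
  have hlw0 : 0 < lw := by positivity
  have hh₀0 : 0 < h₀ := by positivity
  have hκpos : 0 < κ := by positivity
  have hδ₀0 : 0 < δ₀ := by positivity
  -- the constant
  set Cself : ℝ := κ * (16 * r₀ * h₀ + 128 * Real.pi * r₀ * kR ^ 2 * cu ^ 2 / θp + 8 * kR * δ₀ ^ 2 +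
      32 * (e₀ + Q₀) * Rb / r₀ + 32 * Rb * (Q₀ + 16 * Real.pi * (kR ^ 2 * cu ^ 2 + 4 * Q₀ ^ 2 * Rb ^ 2) / θp) +
      e ^ 2 * (e₀ + Q₀) / r₀ ^ 2) + 4 / (θp * Rb) with hCself
  refine ⟨Cself, max 4 (δ₀ ^ 2), by positivity, ?_⟩
  intro Γ θg p t γ α s₀ x hΓ hLmin hx ht hθg hθg1 hgp hsep j θ₁ hθ₁0 hθ₁h hθ₁A htilt hRbθ hγlo hγhi hα hq τ hτ
  -- Γ-level quantities
  have hΓ0 : 0 < Γ := by linarith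
  set G := Real.sqrt Γ with hG
  have hG0 : 0 < G := Real.sqrt_pos.2 hΓ0
  have hG1 : 1 < G := by rw [hG, ← Real.sqrt_one]; exact Real.sqrt_lt_sqrt zero_le_one hΓ
  have hGG : G ^ 2 = Γ := Real.sq_sqrt hΓ0.le
  set L := Real.log Γ with hL
  have hL4 : 4 ≤ L := (le_max_left _ _).trans hLmin
  have hL0 : 0 < L := by linarith
  have hδL : δ₀ ^ 2 ≤ L := (le_max_right _ _).trans hLmin
  set sL := Real.sqrt L with hsL
  have hsL0 : 0 < sL := Real.sqrt_pos.2 hL0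
  have hsLL : sL ^ 2 = L := Real.sq_sqrt hL0.le
  have hsL1 : 1 ≤ sL := by rw [hsL, ← Real.sqrt_one]; exact Real.sqrt_le_sqrt (by linarith)
  have hsL2 : 2 ≤ sL := by
    rw [hsL, show (2:ℝ) = Real.sqrt 4 by rw [show (4:ℝ) = 2 ^ 2 by norm_num, Real.sqrt_sq (by norm_num)]]
    exact Real.sqrt_le_sqrt hL4
  have hδsL : δ₀ ≤ sL := by
    have h := Real.sqrt_le_sqrt hδL
    rwa [Real.sqrt_sq hδ₀0.le] at h
  have hsqrtΓL : Real.sqrt (Γ * L) = G * sL := Real.sqrt_mul hΓ0.le L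
  set ℓ := Rb * Real.sqrt (Γ * Real.log Γ) with hℓdef
  have hℓeq : ℓ = Rb * G * sL := by rw [hℓdef, ← hL, hsqrtΓL, mul_assoc]
  have hℓ0 : 0 < ℓ := by rw [hℓeq]; positivity
  have hℓne : ℓ ≠ 0 := hℓ0.ne'
  -- u and its bounds
  set u := G + |τ| with hu
  have hu0 : 0 < u := by positivity
  have hGu : G ≤ u := by rw [hu]; linarith [abs_nonneg τ]
  have hτu : |τ| ≤ u := by rw [hu]; linarith
  have hucu : u ≤ cu * G * sL := by
    have h1 : G ≤ G * sL := le_mul_of_one_le_right hG0.le hsL1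
    have hτ' : |τ| ≤ 3 * Rb * G * sL := hτ
    have heq : cu * G * sL = G * sL + 3 * Rb * G * sL := by rw [hcu]; ring
    rw [heq, hu]; linarith
  have hu2 : u ^ 2 ≤ cu ^ 2 * Γ * L := by
    have h := pow_le_pow_left₀ hu0.le hucu 2
    calc u ^ 2 ≤ (cu * G * sL) ^ 2 := h
      _ = cu ^ 2 * Γ * L := by rw [mul_pow, mul_pow, hGG, hsLL]
  -- β, c and b
  set β := liaCoeff Γ γ j with hβ
  set c := Γ * γ j / (4 * Real.pi) with hc
  have hγj : 0 < |γ j| := hθp.trans_le hγlo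
  have hγj' : γ j ≠ 0 := abs_pos.1 hγj
  have hβc : β = c * (L / 2) := by rw [hβ, hc, hL]; unfold liaCoeff; ring
  have hβne : β ≠ 0 := by
    rw [hβ]; unfold liaCoeff
    exact div_ne_zero (mul_ne_zero (mul_ne_zero hΓ0.ne' hγj') hL0.ne') (by positivity)
  set b : ℝ := 8 * Real.pi / (θp * Γ * L) with hb
  have hb0 : 0 < b := by positivity
  have hβinv : |β⁻¹| ≤ b := by
    rw [hβ, abs_inv]; unfold liaCoeff
    rw [hb, abs_div, abs_mul, abs_mul, abs_of_pos hΓ0, abs_of_pos hL0, abs_of_pos (by positivity : (0:ℝ) < 8 * Real.pi), inv_div]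
    refine div_le_div_of_nonneg_left (by positivity) (by positivity) ?_
    calc θp * Γ * L = θp * (Γ * L) := by ring
      _ ≤ |γ j| * (Γ * L) := mul_le_mul_of_nonneg_right hγlo (by positivity)
      _ = Γ * |γ j| * L := by ring
  set cΓ : ℝ := Γ / (4 * Real.pi * θp) with hcΓ
  have hγθ : ∀ k, |γ k| * θp ≤ 1 := fun k => by rw [← le_div_iff₀ hθp, one_div]; exact hγhi k
  have h4π : (0:ℝ) < 4 * Real.pi := by positivity
  have hcabs : |c| ≤ cΓ := by
    rw [hc, hcΓ, abs_div, abs_mul, abs_of_pos hΓ0, abs_of_pos h4π, div_le_div_iff₀ h4π (by positivity)]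
    calc Γ * |γ j| * (4 * Real.pi * θp) = (|γ j| * θp) * (4 * Real.pi * Γ) := by ring
      _ ≤ 1 * (4 * Real.pi * Γ) := mul_le_mul_of_nonneg_right (hγθ j) (by positivity)
      _ = Γ * (4 * Real.pi) := by ring
  have hcb : cΓ * b = κ / L := by rw [hcΓ, hb, hκ]; field_simp; ring
  -- geometric quantities of the reference
  set d : ℝ := ρd / 2 * G with hd
  have hd0 : 0 < d := by positivity
  set Bd : ℝ := ∑ k ∈ Finset.univ.erase j, |Γ*γ k/(4*Real.pi)| * (2 / (ρd / 2 * G)) with hBd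
  have hBdle : Bd ≤ B₀ * G := by
    have hterm : ∀ k ∈ Finset.univ.erase j, |Γ*γ k/(4*Real.pi)| * (2 / (ρd / 2 * G)) ≤ G / (Real.pi * θp * ρd) := by
      intro k _
      rw [abs_div, abs_mul, abs_of_pos hΓ0, abs_of_pos h4π, ← hGG]
      have e1 : G ^ 2 * |γ k| / (4 * Real.pi) * (2 / (ρd / 2 * G)) = (|γ k| * θp) * (G / (Real.pi * θp * ρd)) := by
        first | (field_simp; ring) | field_simp
      rw [e1]
      calc (|γ k| * θp) * (G / (Real.pi * θp * ρd)) ≤ 1 * (G / (Real.pi * θp * ρd)) :=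
            mul_le_mul_of_nonneg_right (hγθ k) (by positivity)
        _ = G / (Real.pi * θp * ρd) := one_mul _
    calc Bd ≤ ∑ k ∈ Finset.univ.erase j, G / (Real.pi * θp * ρd) := Finset.sum_le_sum hterm
      _ = (Finset.univ.erase j).card * (G / (Real.pi * θp * ρd)) := by rw [Finset.sum_const, nsmul_eq_mul]
      _ ≤ N * (G / (Real.pi * θp * ρd)) := by
          refine mul_le_mul_of_nonneg_right ?_ (by positivity)
          have : (Finset.univ.erase j).card ≤ N := by
            rw [Finset.card_erase_of_mem (Finset.mem_univ j), Finset.card_univ, Fintype.card_fin]; exact Nat.sub_le N 1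
          exact_mod_cast this
      _ = B₀ * G := by rw [hB₀]; ring
  have hBd0 : 0 ≤ Bd := Finset.sum_nonneg fun k _ => by positivity
  have hQ : 1 / 2 + |α| ≤ Q₀ := by rw [hQ₀]; linarith
  have hw : ‖waistPt Γ p t s₀ j‖ ≤ Rwd * G := by
    rw [waistPt_eq, norm_smul, Real.norm_of_nonneg hG0.le, mul_comm]; exact mul_le_mul_of_nonneg_right (hq j) hG0.le
  -- the parameters of brick S4
  set R := r₀ * G with hR
  have hR0 : 0 < R := by positivity
  set Lw := R + 2 * ℓ with hLw
  have hRL : R ≤ Lw := by rw [hLw]; linarith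
  set ε₀ := b * e₀ * G with hε₀
  set ε₁ := b * Q₀ with hε₁
  set κR := b * kR * u with hκR
  set κ0 := b * (e₀ + Q₀) * u with hκ0
  set κL := b * (kR * u + 2 * Q₀ * Rb * G * sL) with hκL
  set H := b * h₀ with hH
  set θ := 2 * θ₁ with hθ
  have hε₀' : |(liaCoeff Γ γ j)⁻¹| * (Bd + (1/2 + |α|) * ‖waistPt Γ p t s₀ j‖) ≤ ε₀ := by
    rw [← hβ, hε₀]
    have h2 : Bd + (1/2 + |α|) * ‖waistPt Γ p t s₀ j‖ ≤ e₀ * G := by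
      have hm := mul_le_mul hQ hw (norm_nonneg _) hQ₀0.le
      have heq : e₀ * G = B₀ * G + Q₀ * (Rwd * G) := by rw [he₀]; ring
      rw [heq]; linarith
    calc |β⁻¹| * (Bd + (1/2 + |α|) * ‖waistPt Γ p t s₀ j‖) ≤ b * (e₀ * G) :=
          mul_le_mul hβinv h2 (by positivity) hb0.le
      _ = b * e₀ * G := by ring
  have hε₁' : |(liaCoeff Γ γ j)⁻¹| * (1/2 + |α|) ≤ ε₁ := by
    rw [← hβ, hε₁]; exact mul_le_mul hβinv hQ (by positivity) hb0.le
  have hθ' : 2 * θ₁ ≤ θ := le_rfl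
  have hθ1 : θ ≤ 1 := by rw [hθ]; linarith
  have hbe : b * e₀ * G ≤ b * e₀ * u := mul_le_mul_of_nonneg_left hGu (by positivity)
  have hbq : b * Q₀ * |τ| ≤ b * Q₀ * u := mul_le_mul_of_nonneg_left hτu (by positivity)
  have hbr : b * Q₀ * (r₀ * G) ≤ b * Q₀ * (r₀ * u) := mul_le_mul_of_nonneg_left (mul_le_mul_of_nonneg_left hGu hr₀0.le) (by positivity)
  have hκR' : ε₀ + ε₁ * (|τ| + R) ≤ κR := by
    have heq : κR = b * e₀ * u + b * Q₀ * u + b * Q₀ * (r₀ * u) := by rw [hκR, hkR]; ring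
    have heq2 : ε₀ + ε₁ * (|τ| + R) = b * e₀ * G + b * Q₀ * |τ| + b * Q₀ * (r₀ * G) := by rw [hε₀, hε₁, hR]; ring
    rw [heq, heq2]; linarith
  have hκ0' : ε₀ + ε₁ * |τ| ≤ κ0 := by
    have heq : κ0 = b * e₀ * u + b * Q₀ * u := by rw [hκ0]; ring
    have heq2 : ε₀ + ε₁ * |τ| = b * e₀ * G + b * Q₀ * |τ| := by rw [hε₀, hε₁]
    rw [heq, heq2]; linarith
  have hκL' : ε₀ + ε₁ * (|τ| + Lw) ≤ κL := by
    have heq : κL = b * e₀ * u + b * Q₀ * u + b * Q₀ * (r₀ * u) + b * Q₀ * (2 * Rb * G * sL) := by rw [hκL, hkR]; ring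
    have heq2 : ε₀ + ε₁ * (|τ| + Lw) = b * e₀ * G + b * Q₀ * |τ| + b * Q₀ * (r₀ * G) + b * Q₀ * (2 * Rb * G * sL) := by
      rw [hε₀, hε₁, hLw, hR, hℓeq]; ring
    rw [heq, heq2]; linarith
  have hκRR : κR * R ≤ δ₀ / sL := by
    have h1 : κR * R ≤ b * kR * (cu * G * sL) * (r₀ * G) := by
      rw [hκR, hR]; exact mul_le_mul_of_nonneg_right (mul_le_mul_of_nonneg_left hucu (by positivity)) (by positivity)
    have h2 : b * kR * (cu * G * sL) * (r₀ * G) = δ₀ / sL := by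
      rw [hb, hδ₀, eq_div_iff hsL0.ne', ← hGG, ← hsLL]
      first | (field_simp; ring) | field_simp
    rw [← h2]; exact h1
  have hsmall : κR * R ≤ 1 := by
    refine hκRR.trans ?_
    rw [div_le_one hsL0]; exact hδsL
  have hH' : |(liaCoeff Γ γ j)⁻¹| *
      (C * (2 * (‖waistPt Γ p t s₀ j‖ + |τ| + R)) / (Rb * Real.sqrt (Γ * Real.log Γ)) ^ 2 *
          (Bd + (1/2 + |α|) * (‖waistPt Γ p t s₀ j‖ + |τ| + R)) +
        κR * (Bd + (1/2 + |α|) * (‖waistPt Γ p t s₀ j‖ + |τ| + R)) +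
        ((∑ k ∈ Finset.univ.erase j, |Γ*γ k/(4*Real.pi)| * (6 / (ρd / 2 * Real.sqrt Γ) ^ 2)) + (1/2 + |α|))) ≤ H := by
    rw [← hβ, hH, ← hℓdef]
    -- Bx ≤ bx u, Wb ≤ wb u, LW ≤ lw
    have hBx : ‖waistPt Γ p t s₀ j‖ + |τ| + R ≤ bx * u := by
      have h1 : Rwd * G ≤ Rwd * u := mul_le_mul_of_nonneg_left hGu hRwd
      have h2 : r₀ * G ≤ r₀ * u := mul_le_mul_of_nonneg_left hGu hr₀0.le
      have heq : bx * u = Rwd * u + u + r₀ * u := by rw [hbx]; ring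
      rw [heq, hR]; linarith
    have hBx0 : 0 ≤ ‖waistPt Γ p t s₀ j‖ + |τ| + R := by positivity
    have hWb : Bd + (1/2 + |α|) * (‖waistPt Γ p t s₀ j‖ + |τ| + R) ≤ wb * u := by
      have hm := mul_le_mul hQ hBx hBx0 hQ₀0.le
      have h1 : B₀ * G ≤ B₀ * u := mul_le_mul_of_nonneg_left hGu hB₀0
      have heq : wb * u = B₀ * u + Q₀ * (bx * u) := by rw [hwb]; ring
      rw [heq]; linarith
    have hWb0 : 0 ≤ Bd + (1/2 + |α|) * (‖waistPt Γ p t s₀ j‖ + |τ| + R) := by positivity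
    have hLW : (∑ k ∈ Finset.univ.erase j, |Γ*γ k/(4*Real.pi)| * (6 / (ρd / 2 * Real.sqrt Γ) ^ 2)) + (1/2 + |α|) ≤ lw := by
      rw [hlw]
      have hterm : ∀ k ∈ Finset.univ.erase j, |Γ*γ k/(4*Real.pi)| * (6 / (ρd / 2 * Real.sqrt Γ) ^ 2) ≤ 6 / (Real.pi * θp * ρd ^ 2) := by
        intro k _
        rw [← hG, abs_div, abs_mul, abs_of_pos hΓ0, abs_of_pos h4π, ← hGG]
        have e1 : G ^ 2 * |γ k| / (4 * Real.pi) * (6 / (ρd / 2 * G) ^ 2) = (|γ k| * θp) * (6 / (Real.pi * θp * ρd ^ 2)) := by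
          first | (field_simp; ring) | field_simp
        rw [e1]
        calc (|γ k| * θp) * (6 / (Real.pi * θp * ρd ^ 2)) ≤ 1 * (6 / (Real.pi * θp * ρd ^ 2)) :=
              mul_le_mul_of_nonneg_right (hγθ k) (by positivity)
          _ = 6 / (Real.pi * θp * ρd ^ 2) := one_mul _
      have hsum : (∑ k ∈ Finset.univ.erase j, |Γ*γ k/(4*Real.pi)| * (6 / (ρd / 2 * Real.sqrt Γ) ^ 2)) ≤ 6 * N / (Real.pi * θp * ρd ^ 2) := by
        calc _ ≤ ∑ k ∈ Finset.univ.erase j, 6 / (Real.pi * θp * ρd ^ 2) := Finset.sum_le_sum hterm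
          _ = (Finset.univ.erase j).card * (6 / (Real.pi * θp * ρd ^ 2)) := by rw [Finset.sum_const, nsmul_eq_mul]
          _ ≤ N * (6 / (Real.pi * θp * ρd ^ 2)) := by
              refine mul_le_mul_of_nonneg_right ?_ (by positivity)
              have : (Finset.univ.erase j).card ≤ N := by
                rw [Finset.card_erase_of_mem (Finset.mem_univ j), Finset.card_univ, Fintype.card_fin]; exact Nat.sub_le N 1
              exact_mod_cast this
          _ = 6 * N / (Real.pi * θp * ρd ^ 2) := by ring
      linarith
    -- the three pieces against h₀
    have hp1 : C * (2 * (‖waistPt Γ p t s₀ j‖ + |τ| + R)) / ℓ ^ 2 * (Bd + (1/2 + |α|) * (‖waistPt Γ p t s₀ j‖ + |τ| + R)) ≤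
        2 * C * bx * wb * cu ^ 2 / Rb ^ 2 := by
      have hℓ2 : ℓ ^ 2 = Rb ^ 2 * Γ * L := by rw [hℓeq, ← hGG, ← hsLL]; ring
      rw [hℓ2]
      calc C * (2 * (‖waistPt Γ p t s₀ j‖ + |τ| + R)) / (Rb ^ 2 * Γ * L) * (Bd + (1/2 + |α|) * (‖waistPt Γ p t s₀ j‖ + |τ| + R))
          ≤ C * (2 * (bx * u)) / (Rb ^ 2 * Γ * L) * (wb * u) := by gcongr
        _ = 2 * C * bx * wb * (u ^ 2 / (Γ * L)) / Rb ^ 2 := by first | (field_simp; ring) | field_simp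
        _ ≤ 2 * C * bx * wb * cu ^ 2 / Rb ^ 2 := by
            have : u ^ 2 / (Γ * L) ≤ cu ^ 2 := by rw [div_le_iff₀ (by positivity)]; linarith
            gcongr
    have hp2 : κR * (Bd + (1/2 + |α|) * (‖waistPt Γ p t s₀ j‖ + |τ| + R)) ≤ 8 * Real.pi * kR * wb * cu ^ 2 / θp := by
      calc κR * (Bd + (1/2 + |α|) * (‖waistPt Γ p t s₀ j‖ + |τ| + R)) ≤ (b * kR * u) * (wb * u) :=
            mul_le_mul_of_nonneg_left hWb (by positivity)
        _ = 8 * Real.pi * kR * wb * (u ^ 2 / (Γ * L)) / θp := by rw [hb]; first | (field_simp; ring) | field_simp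
        _ ≤ 8 * Real.pi * kR * wb * cu ^ 2 / θp := by
            have : u ^ 2 / (Γ * L) ≤ cu ^ 2 := by rw [div_le_iff₀ (by positivity)]; linarith
            gcongr
    have hsum : C * (2 * (‖waistPt Γ p t s₀ j‖ + |τ| + R)) / ℓ ^ 2 * (Bd + (1/2 + |α|) * (‖waistPt Γ p t s₀ j‖ + |τ| + R)) +
        κR * (Bd + (1/2 + |α|) * (‖waistPt Γ p t s₀ j‖ + |τ| + R)) +
        ((∑ k ∈ Finset.univ.erase j, |Γ*γ k/(4*Real.pi)| * (6 / (ρd / 2 * Real.sqrt Γ) ^ 2)) + (1/2 + |α|)) ≤ h₀ := by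
      rw [hh₀]; linarith
    have hsum0 : 0 ≤ C * (2 * (‖waistPt Γ p t s₀ j‖ + |τ| + R)) / ℓ ^ 2 * (Bd + (1/2 + |α|) * (‖waistPt Γ p t s₀ j‖ + |τ| + R)) +
        κR * (Bd + (1/2 + |α|) * (‖waistPt Γ p t s₀ j‖ + |τ| + R)) +
        ((∑ k ∈ Finset.univ.erase j, |Γ*γ k/(4*Real.pi)| * (6 / (ρd / 2 * Real.sqrt Γ) ^ 2)) + (1/2 + |α|)) := by positivity
    exact mul_le_mul hβinv hsum hsum0 hb0.le
  -- brick S4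
  obtain ⟨-, h4⟩ := hx.selfStrand_sub_lia_le ht hθg hθg1 hgp hρ hsep hΓ0 hℓne j hθ₁0 hθ₁A (fun σ => (htilt σ).trans hRbθ) hC0 hC he0
    hR0 hRL hε₀' hε₁' hθ' hθ1 hκR' hκ0' hκL' hsmall hH'
  -- the Rosenhead coefficient against liaCoeff
  set Λ : ℝ := Real.arsinh (R / e) - R / Real.sqrt (R ^ 2 + e ^ 2) with hΛ
  simp only [he2] at h4
  have hΛ0 : 0 ≤ Λ := liaWindowCoeff_nonneg he0 hR0.le
  have h2e : 2 < Real.exp 1 := by have h := Real.add_one_lt_exp (one_ne_zero (α := ℝ)); linarith only [h]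
  have heR : e ≤ R := by
    rw [hR, hr₀]
    have h1 : 1 ≤ Real.exp 1 / 2 * G := one_le_mul_of_one_le_of_one_le (by linarith only [h2e]) hG1.le
    calc e = e * 1 := (mul_one e).symm
      _ ≤ e * (Real.exp 1 / 2 * G) := mul_le_mul_of_nonneg_left h1 he0.le
      _ = e * Real.exp 1 / 2 * G := by ring
  have hΛL : |Λ - L / 2| ≤ e ^ 2 / R ^ 2 := by
    have h := abs_liaWindowCoeff_sub_log_le he0 heR
    have hlog : Real.log (2 * R / e) - 1 = L / 2 := by
      rw [hR, hr₀, show 2 * (e * Real.exp 1 / 2 * G) / e = Real.exp 1 * G by field_simp, Real.log_mul (Real.exp_pos 1).ne' hG0.ne',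
        Real.log_exp, hG, Real.log_sqrt hΓ0.le, hL]
      ring
    rwa [hlog] at h
  have hΛle : Λ ≤ L := by
    have h1 : Λ ≤ L / 2 + e ^ 2 / R ^ 2 := by have h := (abs_le.1 hΛL).2; linarith only [h]
    have h2 : e ^ 2 / R ^ 2 ≤ 1 := by rw [div_le_one (by positivity)]; exact pow_le_pow_left₀ he0.le heR 2
    linarith only [h1, h2, hL4]
  clear_value Λ
  -- ‖x″τ‖ ≤ κ0
  have hfarτ := hx.dist_partner_ge_of_tilt ht hθg hθg1 hgp hρ hsep j hθ₁0 hθ₁A (fun σ => (htilt σ).trans hRbθ) τ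
  have hx2 : ‖deriv (deriv (x j)) τ‖ ≤ κ0 := by
    have h := hx.curvature_envelope ht j τ hd0 hfarτ
    have h2 : (∑ k ∈ Finset.univ.erase j, |Γ*γ k/(4*Real.pi)| * (2 / d)) + (1/2 + |α|) * (‖waistPt Γ p t s₀ j‖ + |τ|) ≤ (e₀ + Q₀) * u := by
      rw [hd, ← hBd]
      have hm : (1/2 + |α|) * (‖waistPt Γ p t s₀ j‖ + |τ|) ≤ Q₀ * (Rwd * G + |τ|) :=
        mul_le_mul hQ (add_le_add hw (le_refl |τ|)) (by positivity) hQ₀0.le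
      have h1 : B₀ * G ≤ B₀ * u := mul_le_mul_of_nonneg_left hGu hB₀0
      have h3 : Q₀ * (Rwd * G) ≤ Q₀ * (Rwd * u) := mul_le_mul_of_nonneg_left (mul_le_mul_of_nonneg_left hGu hRwd) hQ₀0.le
      have h4 : Q₀ * |τ| ≤ Q₀ * u := mul_le_mul_of_nonneg_left hτu hQ₀0.le
      have heq : (e₀ + Q₀) * u = B₀ * u + Q₀ * (Rwd * u) + Q₀ * u := by rw [he₀]; ring
      calc Bd + (1/2 + |α|) * (‖waistPt Γ p t s₀ j‖ + |τ|) ≤ B₀ * G + Q₀ * (Rwd * G + |τ|) := add_le_add hBdle hm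
        _ = B₀ * G + Q₀ * (Rwd * G) + Q₀ * |τ| := by ring
        _ ≤ B₀ * u + Q₀ * (Rwd * u) + Q₀ * u := add_le_add (add_le_add h1 h3) h4
        _ = (e₀ + Q₀) * u := heq.symm
    calc ‖deriv (deriv (x j)) τ‖ ≤ |β⁻¹| * ((∑ k ∈ Finset.univ.erase j, |Γ*γ k/(4*Real.pi)| * (2 / d)) +
          (1/2 + |α|) * (‖waistPt Γ p t s₀ j‖ + |τ|)) := h
      _ ≤ b * ((e₀ + Q₀) * u) := mul_le_mul hβinv h2 (by positivity) hb0.le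
      _ = κ0 := by rw [hκ0]; ring
  -- split `c • S − β • X = c • (S − Λ • X) + (c Λ − β) • X`
  set S := ∫ σ : ℝ, ((‖x j τ - x j σ‖ ^ 2 + a₀) ^ (3 / 2 : ℝ))⁻¹ • cross (deriv (x j) σ) (x j τ - x j σ) with hS
  set X := cross (deriv (x j) τ) (deriv (deriv (x j)) τ) with hX
  have hXle : ‖X‖ ≤ κ0 := by
    have h := norm_cross_le_norm_mul_norm (deriv (x j) τ) (deriv (deriv (x j)) τ)
    rw [(hx j).2.1 τ, one_mul] at h
    exact h.trans hx2
  have hsplit : c • S - β • X = c • (S - Λ • X) + (c * Λ - β) • X := by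
    rw [smul_sub, sub_smul, smul_smul]; abel
  have hcoef : |c * Λ - β| ≤ cΓ * (e ^ 2 / R ^ 2) := by
    rw [hβc, show c * Λ - c * (L / 2) = c * (Λ - L / 2) by ring, abs_mul]
    exact mul_le_mul hcabs hΛL (abs_nonneg _) (by positivity)
  change ‖c • S - β • X‖ ≤ Cself * u / sL
  rw [hsplit]
  have hmain : ‖c • (S - Λ • X) + (c * Λ - β) • X‖ ≤ cΓ * (16 * R * (H + κR ^ 2) + 8 * (κR * R) ^ 2 * κR * Λ +
      16 * κ0 * Real.log (Lw / R) + 16 * (ε₁ + κL ^ 2) * (Lw - R) + 16 * Real.pi * (θ + θ ^ 2) / Lw) + cΓ * (e ^ 2 / R ^ 2) * κ0 := by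
    refine (norm_add_le _ _).trans (add_le_add ?_ ?_)
    · rw [norm_smul, Real.norm_eq_abs]; exact mul_le_mul hcabs h4 (norm_nonneg _) (by positivity)
    · rw [norm_smul, Real.norm_eq_abs]; exact mul_le_mul hcoef hXle (norm_nonneg _) (by positivity)
  refine hmain.trans ?_
  -- the seven terms, each ≤ const · u/sL (brick B0)
  have hLwℓ : 2 * ℓ ≤ Lw := by rw [hLw]; linarith
  have hLwR : Lw - R = 2 * Rb * G * sL := by rw [hLw, hℓeq]; ring
  have hlogLw : Real.log (Lw / R) ≤ 2 * Rb * sL / r₀ := by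
    have hpos : 0 < Lw / R := by positivity
    have h := Real.log_le_sub_one_of_pos hpos
    have h2 : Lw / R - 1 = 2 * Rb * sL / r₀ := by rw [hLw, hR, hℓeq]; first | (field_simp; ring) | field_simp
    linarith only [h, h2]
  have hcΓ0 : 0 ≤ cΓ := by positivity
  have hκRR2 : (κR * R) ^ 2 ≤ (δ₀ / sL) ^ 2 := pow_le_pow_left₀ (by positivity) hκRR 2
  have hθ0 : 0 ≤ θ := by rw [hθ]; linarith only [hθ₁0]
  have hθ2 : θ + θ ^ 2 ≤ 2 := by nlinarith only [hθ1, hθ0]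
  have T1 := selfTerm_T1 (cΓ := cΓ) hcb hsLL hsL1 hG0.le hGu hκpos.le hr₀0.le hh₀0.le hR hH
  have T2 := selfTerm_T2 (cΓ := cΓ) (kR := kR) hcb hb hsLL hsL1 hG0.le hGu hΓ0 hθp hκpos.le hr₀0.le hu2 hR hκR
  have T3 := selfTerm_T3 (cΓ := cΓ) hcb hsLL hsL1 hG0.le hGu hκpos.le hcΓ0 hkR0.le hb0.le hκRR2 hΛ0 hΛle hκR
  have T4 := selfTerm_T4 (cΓ := cΓ) hcb hsLL hsL1 hG0.le hGu hcΓ0 hb0.le (by positivity : 0 ≤ e₀ + Q₀) hr₀0 hlogLw hκ0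
  have T5 := selfTerm_T5 (cΓ := cΓ) hcb hb hsLL hGG hsL1 hG0.le hGu hΓ0 hθp hκpos.le hcΓ0 hRb.le hQ₀0.le hu2 hLwR hε₁ hκL
  have T6 := selfTerm_T6 (cΓ := cΓ) (u := u) hcΓ hGG hsL1 hG0 hGu hθp hRb hθ2 hℓeq hLwℓ
  have T7 := selfTerm_T7 (cΓ := cΓ) (e := e) hcb hsLL hGG hsL1 hG0 hGu hΓ.le hκpos.le (by positivity : 0 ≤ e₀ + Q₀) hr₀0 hR hκ0
  have htot : cΓ * (16 * R * (H + κR ^ 2) + 8 * (κR * R) ^ 2 * κR * Λ + 16 * κ0 * Real.log (Lw / R) + 16 * (ε₁ + κL ^ 2) * (Lw - R) +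
      16 * Real.pi * (θ + θ ^ 2) / Lw) + cΓ * (e ^ 2 / R ^ 2) * κ0 =
      cΓ * (16 * R * H) + cΓ * (16 * R * κR ^ 2) + cΓ * (8 * (κR * R) ^ 2 * κR * Λ) + cΓ * (16 * κ0 * Real.log (Lw / R)) +
        cΓ * (16 * (ε₁ + κL ^ 2) * (Lw - R)) + cΓ * (16 * Real.pi * (θ + θ ^ 2) / Lw) + cΓ * (e ^ 2 / R ^ 2) * κ0 := by ring
  rw [htot]
  have hfinal : κ * (16 * r₀ * h₀) * (u / sL) + κ * (128 * Real.pi * r₀ * kR ^ 2 * cu ^ 2 / θp) * (u / sL) + κ * (8 * kR * δ₀ ^ 2) * (u / sL) +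
      κ * (32 * (e₀ + Q₀) * Rb / r₀) * (u / sL) + κ * (32 * Rb * (Q₀ + 16 * Real.pi * (kR ^ 2 * cu ^ 2 + 4 * Q₀ ^ 2 * Rb ^ 2) / θp)) * (u / sL) +
      4 / (θp * Rb) * (u / sL) + κ * (e ^ 2 * (e₀ + Q₀) / r₀ ^ 2) * (u / sL) = Cself * u / sL := by
    rw [hCself]; ring
  linarith only [T1, T2, T3, T4, T5, T6, T7, hfinal.le, hfinal.ge]

end Summit.NavierStokesRegularity.NavierStokesRegularity.Theorems.SkeletonJ1RFrame

end
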